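import Summits.HodgeConjecture.HodgeConjecture.Theorems.Ring2WeilCoverageCMFieldZeta7Three
import HarnessLib

/-!
# Ring 2 — Weil-type family-coverage census, CM-field rows (X-Y): the second non-split prime of the sextic table of
# `ℚ(ζ₇)` in the kernel — `[5w] ≠ [1]` (`5 ∤ w`) in `ℚ(ζ₇)⁺^× / Nm ℚ(ζ₇)^×` on Deligne's carrier `R = S³ + 7S²
    + 14S + 7`

HONEST FRAMING: research route conditional on HC_CM; not a corollary; Q11.4-sentence-2 already refuted in dim ≥ 3.

Cell `pub-hodge-ring2`, seat `ring2-b03` (gen 58), census `WEIL-FAMILY-COVERAGE.md` «## b03» b03.23 (`g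
    = 12`, rows `(3,2)`):
the table of `E = ℚ(ζ₇)` over `F = ℚ(ζ₇)⁺` has `T(5)
    = {𝔭₇, (5)}` (the prime `5`, of order `6` mod `7`, is INERT in `F`
— residue field `𝔽₁₂₅` — and INERT in `E/F` — `𝔽₅⁶`). Sequel of part X-X (`[3w] ≠ [1]`), same engine at `ℓ = 5`: the
three integer coordinate forms `N₀, N₁, N₂` of the norm form `a² − σb²` on `1, σ, σ²` are ANISOTROPIC mod `5`
(`5⁶ = 15625` cases, `decide`), and `N = (5wM², 0, 0)` descends. The coordinate lemmas on `F` (`exists_coords_R7`,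
`coords_eq_zero_R7`, `root_rel_R7`) are part X-X's.

* `zeta7_zmod5_anisotropic` (15625 cases), `zeta7_int_descent_five`, `zeta7_rat_no_solution_five`,
  `sq_sub_root_mul_sq_ne_R7_five`; **`zeta7_mk_five_mul_ne_splitDiscriminantClassCM`** (`[5w] ≠ [(−1)²]`, `5 ∤ w`:
  rows `W12.ℚ(ζ₇).[5]`, `[10] (= [5])`, `[15]`, `[20]`, `[30]`, `[35] (= [5])`, `[40]`, … NON-SPLIT),
  `zeta7_mk_five_ne_splitDiscriminantClassCM`, `zeta7_mul_cmConj_ne_five`.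

THEOREMS ONLY: no `def`, no named fact, no `sorry`; `HC_CM` does not occur; nothing about the Hodge conjecture is asserted.

## References
* [Deligne1982HodgeCycles] P. Deligne (notes by J. S. Milne), LNM 900 (1982), §4 p. 30 (1), Cor. 4.2.
* [Washington1997] L. C. Washington, *Introduction to Cyclotomic Fields*, GTM 83, Ch. 2 (`5` is inert in `ℚ(ζ₇)`).
-/

noncomputable section

set_option linter.dupNamespace false

open Polynomial

namespace Summit.HodgeConjecture.HodgeConjecture.Ring2.WeilCoverageCM

open Literature.AlgebraicGeometry.Deligne1982
open Literature.AlgebraicGeometry.HodgeTheory (splitDiscriminantClassCM)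

/-! ### §1 Anisotropy mod 5 (15625 cases) and descent -/

/-- **Anisotropy of `a² − σb²` over `O_E/5 → O_F/5 = 𝔽₁₂₅`** in the coordinates of part X-X: the three coordinate
forms vanish mod `5` only at the origin (`5⁶ = 15625` cases, `decide`). [folklore] -/
theorem zeta7_zmod5_anisotropic :
    ∀ a₀ a₁ a₂ b₀ b₁ b₂ : ZMod 5, 245 * b₂ ^ 2 - 98 * b₁ * b₂ + 7 * b₁ ^ 2 + 14 * b₀ * b₂ + 49 * a₂ ^ 2
        - 14 * a₁ * a₂ + a₀ ^ 2 = 0 → 441 * b₂ ^ 2 - 182 * b₁ * b₂ + 14 * b₁ ^ 2 + 28 * b₀ * b₂ - b₀ ^ 2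
        + 91 * a₂ ^ 2 - 28 * a₁ * a₂ + 2 * a₀ * a₁ = 0 → 154 * b₂ ^ 2 - 70 * b₁ * b₂ + 7 * b₁ ^ 2 + 14 * b₀ * b₂
        - 2 * b₀ * b₁ + 35 * a₂ ^ 2 - 14 * a₁ * a₂ + a₁ ^ 2 + 2 * a₀ * a₂ = 0 →
      a₀ = 0 ∧ a₁ = 0 ∧ a₂ = 0 ∧ b₀ = 0 ∧ b₁ = 0 ∧ b₂ = 0 := by
  decide

/-- **Integer descent at `5`**: `N₀ = 5wM²`, `N₁ = N₂ = 0` with `5 ∤ w` force `M = 0`. [folklore] -/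
theorem zeta7_int_descent_five (w : ℤ) (hw : ¬ (5 : ℤ) ∣ w) :
    ∀ (n : ℕ) (A₀ A₁ A₂ B₀ B₁ B₂ M : ℤ), -(n : ℤ) ≤ M → M ≤ n →
      245 * B₂ ^ 2 - 98 * B₁ * B₂ + 7 * B₁ ^ 2 + 14 * B₀ * B₂ + 49 * A₂ ^ 2 - 14 * A₁ * A₂ + A₀ ^ 2
          = 5 * w * M ^ 2 → 441 * B₂ ^ 2 - 182 * B₁ * B₂ + 14 * B₁ ^ 2 + 28 * B₀ * B₂ - B₀ ^ 2 + 91 * A₂ ^ 2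
          - 28 * A₁ * A₂ + 2 * A₀ * A₁ = 0 → 154 * B₂ ^ 2 - 70 * B₁ * B₂ + 7 * B₁ ^ 2 + 14 * B₀ * B₂
          - 2 * B₀ * B₁ + 35 * A₂ ^ 2 - 14 * A₁ * A₂ + A₁ ^ 2 + 2 * A₀ * A₂ = 0 → M = 0 := by
  have h5p : Prime (5 : ℤ) := Int.prime_iff_natAbs_prime.2 (by norm_num)
  intro n
  induction n with
  | zero => intro A₀ A₁ A₂ B₀ B₁ B₂ M h1 h2 _ _ _; omega
  | succ n ih =>
    intro A₀ A₁ A₂ B₀ B₁ B₂ M h1 h2 hX hY hZ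
    have h3 : (A₀ : ZMod 5) = 0 ∧ (A₁ : ZMod 5) = 0 ∧ (A₂ : ZMod 5) = 0 ∧ (B₀ : ZMod 5) = 0 ∧ (B₁ : ZMod 5) = 0 ∧
        (B₂ : ZMod 5) = 0 := by
      apply zeta7_zmod5_anisotropic
      · have := congrArg (Int.cast : ℤ → ZMod 5) hX
        push_cast at this
        rw [this, show (5 : ZMod 5) = 0 from rfl]
        ring
      · have := congrArg (Int.cast : ℤ → ZMod 5) hY
        push_cast at this
        exact this
      · have := congrArg (Int.cast : ℤ → ZMod 5) hZ
        push_cast at this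
        exact this
    obtain ⟨hA₀, hA₁, hA₂, hB₀, hB₁, hB₂⟩ := h3
    rw [ZMod.intCast_zmod_eq_zero_iff_dvd] at hA₀ hA₁ hA₂ hB₀ hB₁ hB₂
    obtain ⟨A₀', rfl⟩ := hA₀
    obtain ⟨A₁', rfl⟩ := hA₁
    obtain ⟨A₂', rfl⟩ := hA₂
    obtain ⟨B₀', rfl⟩ := hB₀
    obtain ⟨B₁', rfl⟩ := hB₁
    obtain ⟨B₂', rfl⟩ := hB₂
    have hX' : 5 * (245 * B₂' ^ 2 - 98 * B₁' * B₂' + 7 * B₁' ^ 2 + 14 * B₀' * B₂' + 49 * A₂' ^ 2 - 14 * A₁' * A₂'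
        + A₀' ^ 2) = w * M ^ 2 := by
      have h25 : (25 : ℤ) * (245 * B₂' ^ 2 - 98 * B₁' * B₂' + 7 * B₁' ^ 2 + 14 * B₀' * B₂' + 49 * A₂' ^ 2
          - 14 * A₁' * A₂' + A₀' ^ 2) = 5 * w * M ^ 2 := by
        rw [← hX]; ring
      linarith
    have hM5 : (5 : ℤ) ∣ M := by
      have h5 : (5 : ℤ) ∣ w * M ^ 2 := ⟨_, hX'.symm⟩
      rcases (h5p.dvd_or_dvd h5) with h | h
      · exact absurd h hw
      · exact h5p.dvd_of_dvd_pow h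
    obtain ⟨M', rfl⟩ := hM5
    have hX'' : 245 * B₂' ^ 2 - 98 * B₁' * B₂' + 7 * B₁' ^ 2 + 14 * B₀' * B₂' + 49 * A₂' ^ 2 - 14 * A₁' * A₂'
        + A₀' ^ 2 = 5 * w * M' ^ 2 := by
      have : 5 * (245 * B₂' ^ 2 - 98 * B₁' * B₂' + 7 * B₁' ^ 2 + 14 * B₀' * B₂' + 49 * A₂' ^ 2 - 14 * A₁' * A₂'
          + A₀' ^ 2) = 5 * (5 * w * M' ^ 2) := by
        rw [hX']; ring
      exact mul_left_cancel₀ (by norm_num) this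
    have hY'' : 441 * B₂' ^ 2 - 182 * B₁' * B₂' + 14 * B₁' ^ 2 + 28 * B₀' * B₂' - B₀' ^ 2 + 91 * A₂' ^ 2
        - 28 * A₁' * A₂' + 2 * A₀' * A₁' = 0 := by
      have : (25 : ℤ) * (441 * B₂' ^ 2 - 182 * B₁' * B₂' + 14 * B₁' ^ 2 + 28 * B₀' * B₂' - B₀' ^ 2 + 91 * A₂' ^ 2
          - 28 * A₁' * A₂' + 2 * A₀' * A₁') = 0 := by
        rw [← hY]; ring
      exact (mul_eq_zero.1 this).resolve_left (by norm_num)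
    have hZ'' : 154 * B₂' ^ 2 - 70 * B₁' * B₂' + 7 * B₁' ^ 2 + 14 * B₀' * B₂' - 2 * B₀' * B₁' + 35 * A₂' ^ 2
        - 14 * A₁' * A₂' + A₁' ^ 2 + 2 * A₀' * A₂' = 0 := by
      have : (25 : ℤ) * (154 * B₂' ^ 2 - 70 * B₁' * B₂' + 7 * B₁' ^ 2 + 14 * B₀' * B₂' - 2 * B₀' * B₁'
          + 35 * A₂' ^ 2 - 14 * A₁' * A₂' + A₁' ^ 2 + 2 * A₀' * A₂') = 0 := by
        rw [← hZ]; ring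
      exact (mul_eq_zero.1 this).resolve_left (by norm_num)
    have hM' : M' = 0 := ih A₀' A₁' A₂' B₀' B₁' B₂' M' (by push_cast at h1 h2 ⊢; omega)
      (by push_cast at h1 h2 ⊢; omega) hX'' hY'' hZ''
    rw [hM', mul_zero]

/-- **No rational solutions**: `N₀ = 5w`, `N₁ = N₂ = 0` has no solution in `ℚ⁶` when `5 ∤ w`. [folklore] -/
theorem zeta7_rat_no_solution_five (w : ℤ) (hw : ¬ (5 : ℤ) ∣ w) (a₀ a₁ a₂ b₀ b₁ b₂ : ℚ)
    (hX : 245 * b₂ ^ 2 - 98 * b₁ * b₂ + 7 * b₁ ^ 2 + 14 * b₀ * b₂ + 49 * a₂ ^ 2 - 14 * a₁ * a₂ + a₀ ^ 2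
        = 5 * w) (hY : 441 * b₂ ^ 2 - 182 * b₁ * b₂ + 14 * b₁ ^ 2 + 28 * b₀ * b₂ - b₀ ^ 2 + 91 * a₂ ^ 2
        - 28 * a₁ * a₂ + 2 * a₀ * a₁ = 0) (hZ : 154 * b₂ ^ 2 - 70 * b₁ * b₂ + 7 * b₁ ^ 2 + 14 * b₀ * b₂
        - 2 * b₀ * b₁ + 35 * a₂ ^ 2 - 14 * a₁ * a₂ + a₁ ^ 2 + 2 * a₀ * a₂ = 0) : False := by
  set m : ℕ := a₀.den * a₁.den * a₂.den * b₀.den * b₁.den * b₂.den with hm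
  have hm0 : (m : ℤ) ≠ 0 := by
    have : 0 < m := by
      rw [hm]
      exact Nat.mul_pos (Nat.mul_pos (Nat.mul_pos (Nat.mul_pos (Nat.mul_pos a₀.den_pos a₁.den_pos) a₂.den_pos)
        b₀.den_pos) b₁.den_pos) b₂.den_pos
    exact_mod_cast this.ne'
  have key : ∀ (q : ℚ) (k : ℕ), ((q.num * k : ℤ) : ℚ) = q * (q.den * k : ℕ) := by
    intro q k
    push_cast
    rw [← mul_assoc, Rat.mul_den_eq_num]
  obtain ⟨A₀, hA₀⟩ : ∃ A : ℤ, (A : ℚ) = a₀ * m :=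
    ⟨a₀.num * (a₁.den * a₂.den * b₀.den * b₁.den * b₂.den : ℕ), by rw [key, hm]; push_cast; ring⟩
  obtain ⟨A₁, hA₁⟩ : ∃ A : ℤ, (A : ℚ) = a₁ * m :=
    ⟨a₁.num * (a₀.den * a₂.den * b₀.den * b₁.den * b₂.den : ℕ), by rw [key, hm]; push_cast; ring⟩
  obtain ⟨A₂, hA₂⟩ : ∃ A : ℤ, (A : ℚ) = a₂ * m :=
    ⟨a₂.num * (a₀.den * a₁.den * b₀.den * b₁.den * b₂.den : ℕ), by rw [key, hm]; push_cast; ring⟩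
  obtain ⟨B₀, hB₀⟩ : ∃ A : ℤ, (A : ℚ) = b₀ * m :=
    ⟨b₀.num * (a₀.den * a₁.den * a₂.den * b₁.den * b₂.den : ℕ), by rw [key, hm]; push_cast; ring⟩
  obtain ⟨B₁, hB₁⟩ : ∃ A : ℤ, (A : ℚ) = b₁ * m :=
    ⟨b₁.num * (a₀.den * a₁.den * a₂.den * b₀.den * b₂.den : ℕ), by rw [key, hm]; push_cast; ring⟩
  obtain ⟨B₂, hB₂⟩ : ∃ A : ℤ, (A : ℚ) = b₂ * m :=
    ⟨b₂.num * (a₀.den * a₁.den * a₂.den * b₀.den * b₁.den : ℕ), by rw [key, hm]; push_cast; ring⟩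
  have hXZ : 245 * B₂ ^ 2 - 98 * B₁ * B₂ + 7 * B₁ ^ 2 + 14 * B₀ * B₂ + 49 * A₂ ^ 2 - 14 * A₁ * A₂ + A₀ ^ 2
      = 5 * w * (m : ℤ) ^ 2 := by
    have h : (245 * (B₂ : ℚ) ^ 2 - 98 * (B₁ : ℚ) * (B₂ : ℚ) + 7 * (B₁ : ℚ) ^ 2 + 14 * (B₀ : ℚ) * (B₂ : ℚ)
        + 49 * (A₂ : ℚ) ^ 2 - 14 * (A₁ : ℚ) * (A₂ : ℚ) + (A₀ : ℚ) ^ 2 : ℚ) = 5 * w * ((m : ℤ) : ℚ) ^ 2 := by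
      rw [hA₀, hA₁, hA₂, hB₀, hB₁, hB₂]; push_cast; linear_combination ((m : ℚ)) ^ 2 * hX
    exact_mod_cast h
  have hYZ : 441 * B₂ ^ 2 - 182 * B₁ * B₂ + 14 * B₁ ^ 2 + 28 * B₀ * B₂ - B₀ ^ 2 + 91 * A₂ ^ 2 - 28 * A₁ * A₂
      + 2 * A₀ * A₁ = 0 := by
    have h : (441 * (B₂ : ℚ) ^ 2 - 182 * (B₁ : ℚ) * (B₂ : ℚ) + 14 * (B₁ : ℚ) ^ 2 + 28 * (B₀ : ℚ) * (B₂ : ℚ)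
        - (B₀ : ℚ) ^ 2 + 91 * (A₂ : ℚ) ^ 2 - 28 * (A₁ : ℚ) * (A₂ : ℚ) + 2 * (A₀ : ℚ) * (A₁ : ℚ) : ℚ) = 0 := by
      rw [hA₀, hA₁, hA₂, hB₀, hB₁, hB₂]; linear_combination ((m : ℚ)) ^ 2 * hY
    exact_mod_cast h
  have hZZ : 154 * B₂ ^ 2 - 70 * B₁ * B₂ + 7 * B₁ ^ 2 + 14 * B₀ * B₂ - 2 * B₀ * B₁ + 35 * A₂ ^ 2 - 14 * A₁ * A₂
      + A₁ ^ 2 + 2 * A₀ * A₂ = 0 := by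
    have h : (154 * (B₂ : ℚ) ^ 2 - 70 * (B₁ : ℚ) * (B₂ : ℚ) + 7 * (B₁ : ℚ) ^ 2 + 14 * (B₀ : ℚ) * (B₂ : ℚ)
        - 2 * (B₀ : ℚ) * (B₁ : ℚ) + 35 * (A₂ : ℚ) ^ 2 - 14 * (A₁ : ℚ) * (A₂ : ℚ) + (A₁ : ℚ) ^ 2
        + 2 * (A₀ : ℚ) * (A₂ : ℚ) : ℚ) = 0 := by
      rw [hA₀, hA₁, hA₂, hB₀, hB₁, hB₂]; linear_combination ((m : ℚ)) ^ 2 * hZ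
    exact_mod_cast h
  have := zeta7_int_descent_five w hw (m : ℤ).natAbs A₀ A₁ A₂ B₀ B₁ B₂ m (by omega) (by omega) hXZ hYZ hZZ
  exact hm0 this

/-! ### §2 The certificate -/

section Coordinates

variable {R : Polynomial ℤ} [Fact (Irreducible (realPolyQ R))]

/-- **No `a, b ∈ F` with `a² − σb² = 5w`, `5 ∤ w`.** [folklore] -/
theorem sq_sub_root_mul_sq_ne_R7_five (hR : R = X ^ 3 + C 7 * X ^ 2 + C 14 * X + C 7) (w : ℤ) (hw : ¬ (5 : ℤ) ∣ w)
    (a b : realField R) :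
    a ^ 2 - AdjoinRoot.root (realPolyQ R) * b ^ 2 ≠ AdjoinRoot.of (realPolyQ R) (5 * w) := by
  obtain ⟨a₀, a₁, a₂, rfl⟩ := exists_coords_R7 hR a
  obtain ⟨b₀, b₁, b₂, rfl⟩ := exists_coords_R7 hR b
  have hσ := root_rel_R7 hR
  intro h
  have key : AdjoinRoot.of (realPolyQ R) (245 * b₂ ^ 2 - 98 * b₁ * b₂ + 7 * b₁ ^ 2 + 14 * b₀ * b₂ + 49 * a₂ ^ 2
      - 14 * a₁ * a₂ + a₀ ^ 2 - 5 * w) +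
      AdjoinRoot.of (realPolyQ R) (441 * b₂ ^ 2 - 182 * b₁ * b₂ + 14 * b₁ ^ 2 + 28 * b₀ * b₂ - b₀ ^ 2
          + 91 * a₂ ^ 2 - 28 * a₁ * a₂ + 2 * a₀ * a₁) * AdjoinRoot.root (realPolyQ R) +
      AdjoinRoot.of (realPolyQ R) (154 * b₂ ^ 2 - 70 * b₁ * b₂ + 7 * b₁ ^ 2 + 14 * b₀ * b₂ - 2 * b₀ * b₁
          + 35 * a₂ ^ 2 - 14 * a₁ * a₂ + a₁ ^ 2 + 2 * a₀ * a₂) * AdjoinRoot.root (realPolyQ R) ^ 2 = 0 := by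
    simp only [map_add, map_sub, map_mul, map_pow, map_ofNat] at h ⊢
    linear_combination h - ((-35 * AdjoinRoot.of (realPolyQ R) b₂ ^ 2 + 14
        * AdjoinRoot.of (realPolyQ R) b₁ * AdjoinRoot.of (realPolyQ R) b₂ - AdjoinRoot.of (realPolyQ R) b₁ ^ 2
        - 2 * AdjoinRoot.of (realPolyQ R) b₀ * AdjoinRoot.of (realPolyQ R) b₂ - 7
        * AdjoinRoot.of (realPolyQ R) a₂ ^ 2 + 2 * AdjoinRoot.of (realPolyQ R) a₁
        * AdjoinRoot.of (realPolyQ R) a₂) + (7 * AdjoinRoot.of (realPolyQ R) b₂ ^ 2 - 2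
        * AdjoinRoot.of (realPolyQ R) b₁ * AdjoinRoot.of (realPolyQ R) b₂
        + AdjoinRoot.of (realPolyQ R) a₂ ^ 2) * AdjoinRoot.root (realPolyQ R)
        + (-AdjoinRoot.of (realPolyQ R) b₂ ^ 2) * AdjoinRoot.root (realPolyQ R) ^ 2) * hσ
  obtain ⟨hX, hY, hZ⟩ := coords_eq_zero_R7 hR key
  exact zeta7_rat_no_solution_five w hw a₀ a₁ a₂ b₀ b₁ b₂ (by linarith) hY hZ

end Coordinates

/-- **`[5w] ≠ [(−1)²]
    = [1]` in `ℚ(ζ₇)⁺^×/Nm ℚ(ζ₇)^×`, `5 ∤ w`**: rows `W12.ℚ(ζ₇).[5]`, `[10]`, `[15]`, `[20]`, `[30]`, `[40]`,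
… of the `g = 12` table are NON-SPLIT (no `E`-Lagrangian member, Deligne Cor. 4.2). The `Fact` instance arguments are
parts X-V's `zeta7_fact_cmPolyQ rfl`, `zeta7_fact_realPolyQ rfl`. [cite: Deligne1982HodgeCycles, §4 p. 30 (1) and Cor. 4.2] -/
theorem zeta7_mk_five_mul_ne_splitDiscriminantClassCM {R : Polynomial ℤ} (hR : R = X ^ 3 + C 7 * X ^ 2 + C 14 * X
    + C 7)
    [Fact (Irreducible (cmPolyQ R))] [Fact (Irreducible (realPolyQ R))] (w : ℤ) (hw : ¬ (5 : ℤ) ∣ w) (q : (realField R)ˣ)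
    (hq : (q : realField R) = AdjoinRoot.of (realPolyQ R) (5 * w)) :
    (QuotientGroup.mk q : cmNormResidueGroup R) ≠ splitDiscriminantClassCM R 2 := by
  intro h
  rw [splitDiscriminantClassCM, neg_one_sq] at h
  obtain ⟨z, -, hz⟩ := exists_eq_ratCast_mul_norm_of_mk_eq (q := q) (u := 1) (c := 1)
    (by rw [Units.val_one, Rat.cast_one]) h
  rw [Rat.cast_one, one_mul] at hz
  obtain ⟨a, b, rfl⟩ := exists_eq_realToCM_add_mul_cmRoot R z
  rw [norm_coords, algebraMap_realField_eq, hq] at hz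
  exact sq_sub_root_mul_sq_ne_R7_five hR w hw a b ((realToCM R).injective hz).symm

/-- **`[5] ≠ [1]`**: row `W12.ℚ(ζ₇).{𝔭₇, (5)}` of the `g = 12` census table is a non-split component.
[cite: Deligne1982HodgeCycles, §4 p. 30 (1) and Cor. 4.2] -/
theorem zeta7_mk_five_ne_splitDiscriminantClassCM {R : Polynomial ℤ} (hR : R = X ^ 3 + C 7 * X ^ 2 + C 14 * X + C 7)
    [Fact (Irreducible (cmPolyQ R))] [Fact (Irreducible (realPolyQ R))] (q : (realField R)ˣ)
    (hq : (q : realField R) = 5) :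
    (QuotientGroup.mk q : cmNormResidueGroup R) ≠ splitDiscriminantClassCM R 2 :=
  zeta7_mk_five_mul_ne_splitDiscriminantClassCM hR 1 (by norm_num) q (by rw [hq]; simp)

/-- **No `z ∈ ℚ(ζ₇)` has `z z̄
    = 5`** (`5` is not a norm from `ℚ(ζ₇)` to `ℚ(ζ₇)⁺`). [cite: Deligne1982HodgeCycles, §4 p. 30] -/
theorem zeta7_mul_cmConj_ne_five {R : Polynomial ℤ} (hR : R = X ^ 3 + C 7 * X ^ 2 + C 14 * X + C 7)
    [Fact (Irreducible (cmPolyQ R))] [Fact (Irreducible (realPolyQ R))] (z : cmField R) : z * cmConj R z ≠ 5 := by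
  obtain ⟨a, b, rfl⟩ := exists_eq_realToCM_add_mul_cmRoot R z
  rw [norm_coords]
  intro h
  have h5 : realToCM R (AdjoinRoot.of (realPolyQ R) (5 * (1 : ℤ))) = 5 := by
    rw [Int.cast_one, mul_one, realToCM_of]
    exact map_ofNat (algebraMap ℚ (cmField R)) 5
  rw [← h5] at h
  exact sq_sub_root_mul_sq_ne_R7_five hR 1 (by norm_num) a b ((realToCM R).injective h)

end Summit.HodgeConjecture.HodgeConjecture.Ring2.WeilCoverageCM

end
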